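import Literature.MathematicalPhysics.QuantumLattice.InfVolFermionStateTorusLimitTwoSectorEnergyEntropyBalance
import HarnessLib

/-!
# Stationarity and gauge-invariant energy–entropy balance rows for torus limits of the canonical Gibbs
# states of a GENERAL spin sector `(N↑, N↓) = (a_L, b_L)` of the `t–t'` Hubbard model — the reader-law
# core of the COMPANION states of the two-sector rows

Topic `Literature/MathematicalPhysics/QuantumLattice`; complement of
`InfVolFermionStateTorusLimitEnergyEntropyBalance.lean` (the same two row families for the object of
record, the torus limits of the `(rectN n L, S^z = 0)` canonical Gibbs states) and of the two-sector files
`InfVolFermionStateTorusLimitTwoSector*.lean`: a two-state relaxation for the charged rows of the canonical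
object carries one copy of its moment variables for the COMPANION limit `ω'` (a torus limit of the
canonical Gibbs eigen-mixtures of the image spin sector `(a_L, b_L)`, e.g. `(k_L − 1, k_L)` for `c_{x↑}`),
and that copy must be constrained by the companion's own valid rows. This file supplies the two that
distinguish a thermal state — for ANY sector sequence `(a_L, b_L)` and any enumeration of the eigen-data:

* `IsTorusLimitOfMixture.expect_commutator_localHamiltonian_eq_zero_of_spinSectorGibbs` — the
  STATIONARITY rows `ω'_{Λ'}(H_{Λ'}ΓB − ΓB H_{Λ'}) = 0` for every local `B ∈ 𝔄_Λ` (`thicken Λ 1 ⊆ Λ'`);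
* `IsTorusLimitOfMixture.re_expect_eeb_nonneg_of_spinSectorGibbs` (and `…_of_thicken_subset`) — the
  linearised energy–entropy balance rows `0 ≤ Re ω'(β·Ãᴴ(H_{Λ₁}Ã − ÃH_{Λ₁}) − s·ÃᴴÃ + q·ÃÃᴴ)`,
  `e^{s−1} ≤ q`, for every local generator `A` conserving the local `N` and `S^z` (such a generator preserves
  every joint sector, `mulVec_mem_szSector_of_commute`),

with the fixed-`L` torus-average statements for a general spin sector in §1. Translation invariance of
`ω'` is `IsTorusLimitOfMixture.isTranslationInvariant` (any mixture); `D₄`-invariance and the charged-word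
nulls generalise likewise but are not needed here; SPIN-FLIP invariance does NOT hold for `a_L ≠ b_L`.
Everything is PROVED; no definition, no named fact.

## Mathlib / tree search

REUSED: `sum_canonicalWeight_mul_re_expect_eeb_mulVec_nonneg`, `star_mulVec_dotProduct_commutator_mulVec_mulVec_eq_zero`,
`fockTranslate_val_conjTranspose_mul_val_mul`, `fockTranslate_val_mul_val_conjTranspose_mul`,
`fockTranslate_val_conjTranspose_eq_neg` (`TorusGibbsEnergyEntropyBalance`); `hubbardTorusTT'_apply_eq_zero_of_spinConfig`,
`apply_eq_zero_of_spinConfig_of_mulVec_mem`, `fockTranslate_apply_eq_zero_of_spinConfig`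
(`TorusGibbsTwoSectorEnergyEntropyBalance`); `mulVec_mem_szSector_of_commute`,
`commute_fermionEmbed_toTorusEmb_totalNumber/spinZ`, `hubbardTorusTT'_commutator_fermionEmbed`,
`hubbardTTPrime_localHamiltonian_commutator_fermionEmbed_eq`, `mulVec_sectorEigenvector`,
`fockTranslate_commute_hubbardTorusTT'`, `torusAvgExpectAt_of_injOn`, `torusAvgExpect_eq`,
`eventually_injOn_proj_of_tendsto`, `totalNumber_eq_numberDiag_univ`, `numberDiag_conjTranspose`,
`HubbardWave0.spinZ_isHermitian`. `lean search 'spinSectorGibbs|of_spinConfig.*eeb'`: nothing (2026-08-27).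

## References

* H. Fawzi, O. Fawzi, S. O. Scalet (2024), Thm. 3.1 (stationarity + EEB ⟺ KMS; the linear rows).
  [cite: FawziFawziScalet2024, Thm. 3.1]
* O. Bratteli, D. W. Robinson, *Operator Algebras and Quantum Statistical Mechanics 2* (1997),
  Thm. 5.3.15. [cite: BratteliRobinsonII1997, Thm. 5.3.15]
* E. H. Lieb, Phys. Rev. Lett. 62 (1989) 1201, Remark (2). [cite: LiebPRL1989, Remark (2)]
-/

noncomputable section

namespace Literature.MathematicalPhysics.QuantumLattice

open Matrix Finset HubbardWave0 Literature.Probability.LatticeModels ThermodynamicLimit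
open _root_.Filter
open scoped _root_.Topology ComplexOrder BigOperators

/-! ### §1 Fixed side `L`: the two row families for the canonical eigen-mixture of a spin sector -/

section Torus

variable (L : ℕ) [NeZero L] (t t' U β : ℝ)

/-- Real part of a weighted translation average. [folklore] -/
private theorem re_sum_mul_avg' {κ : Type*} [Fintype κ] (w : κ → ℝ) (N : ℕ)
    (f : κ → TorusSite 2 L → ℂ) :
    (∑ c, (w c : ℂ) * (((N : ℂ))⁻¹ * ∑ v, f c v)).re = (N : ℝ)⁻¹ * ∑ v, ∑ c, w c * (f c v).re := by
  have hcast : ((N : ℂ))⁻¹ = (((N : ℝ)⁻¹ : ℝ) : ℂ) := by push_cast; rfl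
  rw [Complex.re_sum]
  simp_rw [hcast, ← mul_assoc, ← Complex.ofReal_mul, Complex.re_ofReal_mul, Complex.re_sum, Finset.mul_sum]
  rw [Finset.sum_comm]
  refine Finset.sum_congr rfl fun v _ => Finset.sum_congr rfl fun c _ => by ring

omit [NeZero L] in
/-- A torus operator commuting with `N` and `S^z` has no entries from the spin sector `(a, b)` into its
complement, and neither has its adjoint. [cite: LiebPRL1989, Remark (2)] -/
theorem apply_eq_zero_of_spinConfig_of_commute (a b : ℕ)
    {B : Matrix (Finset (Orb (FermionTorus 2 L))) (Finset (Orb (FermionTorus 2 L))) ℂ}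
    (hN : Commute B totalNumber) (hS : Commute B HubbardWave0.spinZ) :
    (∀ s s', ¬ spinConfig a b s → spinConfig a b s' → B s s' = 0) ∧
      (∀ s s', ¬ spinConfig a b s → spinConfig a b s' → Bᴴ s s' = 0) := by
  have hNh : (totalNumber : Matrix (Finset (Orb (FermionTorus 2 L))) (Finset (Orb (FermionTorus 2 L))) ℂ)ᴴ =
      totalNumber := by
    rw [totalNumber_eq_numberDiag_univ]
    exact numberDiag_conjTranspose _
  have hN' : Commute Bᴴ totalNumber := by
    have h := congrArg conjTranspose hN.eq
    rw [conjTranspose_mul, conjTranspose_mul, hNh] at h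
    exact h.symm
  have hS' : Commute Bᴴ HubbardWave0.spinZ := by
    have h := congrArg conjTranspose hS.eq
    rw [conjTranspose_mul, conjTranspose_mul, HubbardWave0.spinZ_isHermitian.eq] at h
    exact h.symm
  exact ⟨apply_eq_zero_of_spinConfig_of_mulVec_mem L (fun _ hw => mulVec_mem_szSector_of_commute hN hS hw),
    apply_eq_zero_of_spinConfig_of_mulVec_mem L (fun _ hw => mulVec_mem_szSector_of_commute hN' hS' hw)⟩

/-- **Gauge-invariant EEB rows for the torus-averaged canonical eigen-mixture of a spin sector.** For
`H_L = hubbardTorusTT' L t t' U`, the canonical eigen-data `(w_c, ψ_c)` of `H_L|_{(a,b)}`, `Λ₁ = thicken Λ 1`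
with `x ↦ x mod L` injective on `thicken Λ₁ 1`, a local `A ∈ 𝔄_Λ` commuting with the local `N` and `S^z`,
`Ã = Γ_{Λ⊆Λ₁}A`, and `e^{s−1} ≤ q`:
`0 ≤ Re Σ_c w_c·⟨β·Ãᴴ(H_{Λ₁}Ã − ÃH_{Λ₁}) − s·ÃᴴÃ + q·ÃÃᴴ⟩^{avg}_{ψ_c}`.
[cite: FawziFawziScalet2024, Thm. 3.1] -/
theorem re_sum_canonicalWeight_mul_torusAvgExpectAt_eeb_nonneg_spinSector (a b : ℕ) {Λ : Finset (Site 2)}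
    (hInj : Set.InjOn (Torus.proj (d := 2) L) ↑(thicken (thicken Λ 1) 1))
    {A : FermionOp Λ} (hAN : Commute A totalNumber) (hAS : Commute A HubbardWave0.spinZ)
    {s q : ℝ} (hq : Real.exp (s - 1) ≤ q) :
    0 ≤ (∑ c, (canonicalWeight β (sectorEigenvalue (spinConfig a b) (hubbardTorusTT' L t t' U)
          (hubbardTorusTT'_isHermitian L t t' U)) c : ℂ) *
      torusAvgExpectAt L (thicken Λ 1)
        (((β : ℝ) : ℂ) • ((fermionEmbed (PolySite.incl (subset_thicken Λ 1)) A)ᴴ *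
            ((hubbardTTPrimeFermionInteraction t t' U).localHamiltonian (thicken Λ 1) *
                fermionEmbed (PolySite.incl (subset_thicken Λ 1)) A -
              fermionEmbed (PolySite.incl (subset_thicken Λ 1)) A *
                (hubbardTTPrimeFermionInteraction t t' U).localHamiltonian (thicken Λ 1))) -
          ((s : ℝ) : ℂ) • ((fermionEmbed (PolySite.incl (subset_thicken Λ 1)) A)ᴴ *
            fermionEmbed (PolySite.incl (subset_thicken Λ 1)) A) +
          ((q : ℝ) : ℂ) • (fermionEmbed (PolySite.incl (subset_thicken Λ 1)) A *
            (fermionEmbed (PolySite.incl (subset_thicken Λ 1)) A)ᴴ))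
        (sectorEigenvector (spinConfig a b) (hubbardTorusTT' L t t' U)
          (hubbardTorusTT'_isHermitian L t t' U) c)).re := by
  have h₁ : Set.InjOn (Torus.proj (d := 2) L) ↑(thicken Λ 1) :=
    hInj.mono (by exact_mod_cast subset_thicken (thicken Λ 1) 1)
  have hΛ : Set.InjOn (Torus.proj (d := 2) L) ↑Λ :=
    hInj.mono (by exact_mod_cast (subset_thicken Λ 1).trans (subset_thicken (thicken Λ 1) 1))
  set H := hubbardTorusTT' L t t' U with hHdef
  set hH := hubbardTorusTT'_isHermitian L t t' U with hhH
  set B := fermionEmbed (PolySite.toTorusEmb L hΛ) A with hBdef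
  have hB : fermionEmbed (PolySite.toTorusEmb L h₁) (fermionEmbed (PolySite.incl (subset_thicken Λ 1)) A) = B := by
    rw [hBdef, fermionEmbed_fermionEmbed]
    exact congrFun (congrArg DFunLike.coe (fermionEmbed_congr fun p => rfl)) A
  have hBN : Commute B totalNumber := commute_fermionEmbed_toTorusEmb_totalNumber L hΛ hAN
  have hBS : Commute B HubbardWave0.spinZ := commute_fermionEmbed_toTorusEmb_spinZ L hΛ hAS
  -- pull the row back into the torus
  have hΓ : fermionEmbed (PolySite.toTorusEmb L h₁)
      (((β : ℝ) : ℂ) • ((fermionEmbed (PolySite.incl (subset_thicken Λ 1)) A)ᴴ *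
            ((hubbardTTPrimeFermionInteraction t t' U).localHamiltonian (thicken Λ 1) *
                fermionEmbed (PolySite.incl (subset_thicken Λ 1)) A -
              fermionEmbed (PolySite.incl (subset_thicken Λ 1)) A *
                (hubbardTTPrimeFermionInteraction t t' U).localHamiltonian (thicken Λ 1))) -
          ((s : ℝ) : ℂ) • ((fermionEmbed (PolySite.incl (subset_thicken Λ 1)) A)ᴴ *
            fermionEmbed (PolySite.incl (subset_thicken Λ 1)) A) +
          ((q : ℝ) : ℂ) • (fermionEmbed (PolySite.incl (subset_thicken Λ 1)) A *
            (fermionEmbed (PolySite.incl (subset_thicken Λ 1)) A)ᴴ)) =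
      ((β : ℝ) : ℂ) • (Bᴴ * (H * B - B * H)) - ((s : ℝ) : ℂ) • (Bᴴ * B) + ((q : ℝ) : ℂ) • (B * Bᴴ) := by
    rw [fermionEmbed_add, fermionEmbed_sub, fermionEmbed_smul, fermionEmbed_smul, fermionEmbed_smul,
      fermionEmbed_mul, fermionEmbed_mul, fermionEmbed_mul, fermionEmbed_conjTranspose,
      ← hubbardTorusTT'_commutator_fermionEmbed L t t' U (subset_thicken Λ 1) subset_rfl hInj A, hB]
  -- sector bookkeeping
  have hinv : ∀ s s', ¬ spinConfig a b s → spinConfig a b s' → H s s' = 0 :=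
    fun s s' hs hs' => hubbardTorusTT'_apply_eq_zero_of_spinConfig L t t' U a b s s' hs hs'
  obtain ⟨hBp, hBp'⟩ := apply_eq_zero_of_spinConfig_of_commute L a b hBN hBS
  -- each translate is nonnegative
  have hv : ∀ v : TorusSite 2 L, 0 ≤ ∑ c, canonicalWeight β (sectorEigenvalue (spinConfig a b) H hH) c *
      (expect (((β : ℝ) : ℂ) • (Bᴴ * (H * B - B * H)) - ((s : ℝ) : ℂ) • (Bᴴ * B) + ((q : ℝ) : ℂ) • (B * Bᴴ))
        ((fockTranslate v).val *ᵥ sectorEigenvector (spinConfig a b) H hH c)).re := by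
    intro v
    have hUp' : ∀ s s', ¬ spinConfig a b s → spinConfig a b s' → (fockTranslate v).valᴴ s s' = 0 := by
      intro s s' hs hs'
      rw [fockTranslate_val_conjTranspose_eq_neg]
      exact fockTranslate_apply_eq_zero_of_spinConfig L (-v) a b s s' hs hs'
    exact sum_canonicalWeight_mul_re_expect_eeb_mulVec_nonneg (spinConfig a b) hH hinv
      (fockTranslate_val_conjTranspose_mul_val_mul L v) (fockTranslate_val_mul_val_conjTranspose_mul L v)
      (fockTranslate_commute_hubbardTorusTT' L v t t' U)
      (fun s s' hs hs' => fockTranslate_apply_eq_zero_of_spinConfig L v a b s s' hs hs') hUp' hBp hBp' β hq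
  simp_rw [torusAvgExpectAt_of_injOn L h₁, hΓ, re_sum_mul_avg']
  exact mul_nonneg (inv_nonneg.2 (Nat.cast_nonneg _)) (Finset.sum_nonneg fun v _ => hv v)

/-- **The stationarity row vanishes in every eigenvector of a spin sector**: for `Λ ⊆ Λ'`,
`thicken Λ 1 ⊆ Λ'`, `x ↦ x mod L` injective on `thicken Λ' 1` and every local `B ∈ 𝔄_Λ`,
`⟨H_{Λ'}ΓB − ΓB H_{Λ'}⟩^{avg}_{ψ_c} = 0` for the eigenvectors `ψ_c` of `H_L|_{(a,b)}`.
[cite: FawziFawziScalet2024, Thm. 3.1] -/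
theorem torusAvgExpectAt_commutator_localHamiltonian_sectorEigenvector_spinSector (a b : ℕ)
    {Λ Λ' : Finset (Site 2)} (hΛ : Λ ⊆ Λ') (h8 : thicken Λ 1 ⊆ Λ')
    (hInj : Set.InjOn (Torus.proj (d := 2) L) ↑(thicken Λ' 1)) (B : FermionOp Λ)
    (c : Subtype (spinConfig (Λ := FermionTorus 2 L) a b)) :
    torusAvgExpectAt L Λ'
        ((hubbardTTPrimeFermionInteraction t t' U).localHamiltonian Λ' * fermionEmbed (PolySite.incl hΛ) B -
          fermionEmbed (PolySite.incl hΛ) B * (hubbardTTPrimeFermionInteraction t t' U).localHamiltonian Λ')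
        (sectorEigenvector (spinConfig a b) (hubbardTorusTT' L t t' U) (hubbardTorusTT'_isHermitian L t t' U) c) = 0 := by
  have h₁ : Set.InjOn (Torus.proj (d := 2) L) ↑Λ' := hInj.mono (by exact_mod_cast subset_thicken Λ' 1)
  rw [torusAvgExpectAt_of_injOn L h₁, ← hubbardTorusTT'_commutator_fermionEmbed L t t' U hΛ h8 hInj B,
    Finset.sum_eq_zero fun v _ => ?_, mul_zero]
  rw [expect]
  exact star_mulVec_dotProduct_commutator_mulVec_mulVec_eq_zero (hubbardTorusTT'_isHermitian L t t' U)
    (fockTranslate_commute_hubbardTorusTT' L v t t' U)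
    (mulVec_sectorEigenvector (spinConfig a b) (hubbardTorusTT'_isHermitian L t t' U)
      (fun s s' hs hs' => hubbardTorusTT'_apply_eq_zero_of_spinConfig L t t' U a b s s' hs hs') c) _

end Torus

/-! ### §2 The rows of torus limits of spin-sector canonical mixtures -/

namespace InfVolFermionState

variable (t t' U β : ℝ)

/-- Reindexing a weighted sum of torus averages along an enumeration of the sector. [folklore] -/
private theorem sum_reindex_torusAvg'' {L : ℕ} [NeZero L] {P : Finset (Orb (FermionTorus 2 L)) → Prop}
    [DecidablePred P] {m : ℕ} (e : Fin m ≃ Subtype P) (w : Subtype P → ℝ)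
    (φ : Subtype P → Fock (Orb (FermionTorus 2 L))) {p : Fin m → ℝ}
    {ψ : Fin m → Fock (Orb (FermionTorus 2 L))} (hp : ∀ i, p i = w (e i)) (hψ : ∀ i, ψ i = φ (e i))
    {Λ : Finset (Site 2)} (X : FermionOp Λ) :
    ∑ i, (p i : ℂ) * torusAvgExpect L Λ X (ψ i) = ∑ c, (w c : ℂ) * torusAvgExpectAt L Λ X (φ c) := by
  simp_rw [torusAvgExpect_eq, hp, hψ]
  exact Equiv.sum_comp e (fun c => (w c : ℂ) * torusAvgExpectAt L Λ X (φ c))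

/-- **Stationarity rows of torus limits of spin-sector canonical Gibbs states.** Let `ω` be a torus limit
along `Ls → ∞` of the canonical Gibbs eigen-mixtures (weights `canonicalWeight`, vectors `sectorEigenvector`,
any enumerations `e_L`) of `hubbardTorusTT' L t t' U` on the spin sectors `(a_L, b_L)`. Then for `Λ ⊆ Λ'`
with `thicken Λ 1 ⊆ Λ'` and every local `B ∈ 𝔄_Λ`: `ω_{Λ'}(H^{tt'U}_{Λ'}ΓB − ΓB H^{tt'U}_{Λ'}) = 0`.
[cite: FawziFawziScalet2024, Thm. 3.1] -/
theorem IsTorusLimitOfMixture.expect_commutator_localHamiltonian_eq_zero_of_spinSectorGibbs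
    (a b : ℕ → ℕ) {m : ℕ → ℕ} {p : ∀ L, Fin (m L) → ℝ} {ψ : ∀ L, Fin (m L) → Fock (Orb (FermionTorus 2 L))}
    (e : ∀ L, Fin (m L) ≃ Subtype (spinConfig (Λ := FermionTorus 2 L) (a L) (b L)))
    (hp : ∀ L i, p L i = canonicalWeight β (sectorEigenvalue (spinConfig (a L) (b L)) (hubbardTorusTT' L t t' U)
      (hubbardTorusTT'_isHermitian L t t' U)) (e L i))
    (hψ : ∀ L i, ψ L i = sectorEigenvector (spinConfig (a L) (b L)) (hubbardTorusTT' L t t' U)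
      (hubbardTorusTT'_isHermitian L t t' U) (e L i))
    {Ls : ℕ → ℕ} (hLs : Tendsto Ls atTop atTop) {ω : InfVolFermionState 2}
    (hω : ω.IsTorusLimitOfMixture m p ψ Ls)
    {Λ Λ' : Finset (Site 2)} (hΛ : Λ ⊆ Λ') (h8 : thicken Λ 1 ⊆ Λ') (B : FermionOp Λ) :
    ω.expect Λ'
      ((hubbardTTPrimeFermionInteraction t t' U).localHamiltonian Λ' * fermionEmbed (PolySite.incl hΛ) B -
        fermionEmbed (PolySite.incl hΛ) B * (hubbardTTPrimeFermionInteraction t t' U).localHamiltonian Λ') = 0 := by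
  refine tendsto_nhds_unique (hω Λ' _) (tendsto_const_nhds.congr' ?_)
  filter_upwards [eventually_injOn_proj_of_tendsto (thicken Λ' 1) hLs, hLs.eventually_ge_atTop 1]
    with j hInj hj
  haveI : NeZero (Ls j) := ⟨by omega⟩
  rw [sum_reindex_torusAvg'' (e (Ls j)) _ _ (hp (Ls j)) (hψ (Ls j))]
  refine (Finset.sum_eq_zero fun c _ => ?_).symm
  rw [torusAvgExpectAt_commutator_localHamiltonian_sectorEigenvector_spinSector (Ls j) t t' U (a (Ls j))
    (b (Ls j)) hΛ h8 hInj B c, mul_zero]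

/-- **Gauge-invariant energy–entropy balance rows of torus limits of spin-sector canonical Gibbs states.**
Under the same hypotheses, for every region `Λ`, every local `A ∈ 𝔄_Λ` commuting with the local `N` and
`S^z`, and all real `s, q` with `e^{s−1} ≤ q`:
`0 ≤ Re ω_{Λ₁}(β·Ãᴴ(H^{tt'U}_{Λ₁}Ã − ÃH^{tt'U}_{Λ₁}) − s·ÃᴴÃ + q·ÃÃᴴ)`, `Λ₁ = thicken Λ 1`, `Ã = Γ_{Λ⊆Λ₁}A`.
[cite: FawziFawziScalet2024, Thm. 3.1] [cite: BratteliRobinsonII1997, Thm. 5.3.15] -/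
theorem IsTorusLimitOfMixture.re_expect_eeb_nonneg_of_spinSectorGibbs
    (a b : ℕ → ℕ) {m : ℕ → ℕ} {p : ∀ L, Fin (m L) → ℝ} {ψ : ∀ L, Fin (m L) → Fock (Orb (FermionTorus 2 L))}
    (e : ∀ L, Fin (m L) ≃ Subtype (spinConfig (Λ := FermionTorus 2 L) (a L) (b L)))
    (hp : ∀ L i, p L i = canonicalWeight β (sectorEigenvalue (spinConfig (a L) (b L)) (hubbardTorusTT' L t t' U)
      (hubbardTorusTT'_isHermitian L t t' U)) (e L i))
    (hψ : ∀ L i, ψ L i = sectorEigenvector (spinConfig (a L) (b L)) (hubbardTorusTT' L t t' U)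
      (hubbardTorusTT'_isHermitian L t t' U) (e L i))
    {Ls : ℕ → ℕ} (hLs : Tendsto Ls atTop atTop) {ω : InfVolFermionState 2}
    (hω : ω.IsTorusLimitOfMixture m p ψ Ls)
    {Λ : Finset (Site 2)} {A : FermionOp Λ}
    (hAN : Commute A totalNumber) (hAS : Commute A HubbardWave0.spinZ)
    {s q : ℝ} (hq : Real.exp (s - 1) ≤ q) :
    0 ≤ (ω.expect (thicken Λ 1)
      (((β : ℝ) : ℂ) • ((fermionEmbed (PolySite.incl (subset_thicken Λ 1)) A)ᴴ *
          ((hubbardTTPrimeFermionInteraction t t' U).localHamiltonian (thicken Λ 1) *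
              fermionEmbed (PolySite.incl (subset_thicken Λ 1)) A -
            fermionEmbed (PolySite.incl (subset_thicken Λ 1)) A *
              (hubbardTTPrimeFermionInteraction t t' U).localHamiltonian (thicken Λ 1))) -
        ((s : ℝ) : ℂ) • ((fermionEmbed (PolySite.incl (subset_thicken Λ 1)) A)ᴴ *
          fermionEmbed (PolySite.incl (subset_thicken Λ 1)) A) +
        ((q : ℝ) : ℂ) • (fermionEmbed (PolySite.incl (subset_thicken Λ 1)) A *
          (fermionEmbed (PolySite.incl (subset_thicken Λ 1)) A)ᴴ))).re := by
  refine ge_of_tendsto ((Complex.continuous_re.tendsto _).comp (hω (thicken Λ 1) _)) ?_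
  filter_upwards [eventually_injOn_proj_of_tendsto (thicken (thicken Λ 1) 1) hLs, hLs.eventually_ge_atTop 1]
    with j hInj hj
  haveI : NeZero (Ls j) := ⟨by omega⟩
  rw [Function.comp_apply, sum_reindex_torusAvg'' (e (Ls j)) _ _ (hp (Ls j)) (hψ (Ls j))]
  exact re_sum_canonicalWeight_mul_torusAvgExpectAt_eeb_nonneg_spinSector (Ls j) t t' U β (a (Ls j)) (b (Ls j))
    hInj hAN hAS hq

/-- **The EEB rows in an arbitrary window** `Λ' ⊇ thicken Λ 1` (`Λ ⊆ Λ'`), the shape a window certificate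
carries: `0 ≤ Re ω_{Λ'}(β·(ΓA)ᴴ(H_{Λ'}ΓA − ΓA H_{Λ'}) − s·(ΓA)ᴴΓA + q·ΓA(ΓA)ᴴ)`.
[cite: FawziFawziScalet2024, Thm. 3.1] -/
theorem IsTorusLimitOfMixture.re_expect_eeb_nonneg_of_spinSectorGibbs_of_thicken_subset
    (a b : ℕ → ℕ) {m : ℕ → ℕ} {p : ∀ L, Fin (m L) → ℝ} {ψ : ∀ L, Fin (m L) → Fock (Orb (FermionTorus 2 L))}
    (e : ∀ L, Fin (m L) ≃ Subtype (spinConfig (Λ := FermionTorus 2 L) (a L) (b L)))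
    (hp : ∀ L i, p L i = canonicalWeight β (sectorEigenvalue (spinConfig (a L) (b L)) (hubbardTorusTT' L t t' U)
      (hubbardTorusTT'_isHermitian L t t' U)) (e L i))
    (hψ : ∀ L i, ψ L i = sectorEigenvector (spinConfig (a L) (b L)) (hubbardTorusTT' L t t' U)
      (hubbardTorusTT'_isHermitian L t t' U) (e L i))
    {Ls : ℕ → ℕ} (hLs : Tendsto Ls atTop atTop) {ω : InfVolFermionState 2}
    (hω : ω.IsTorusLimitOfMixture m p ψ Ls)
    {Λ Λ' : Finset (Site 2)} (hΛ : Λ ⊆ Λ') (h8 : thicken Λ 1 ⊆ Λ')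
    {A : FermionOp Λ} (hAN : Commute A totalNumber) (hAS : Commute A HubbardWave0.spinZ)
    {s q : ℝ} (hq : Real.exp (s - 1) ≤ q) :
    0 ≤ (ω.expect Λ'
      (((β : ℝ) : ℂ) • ((fermionEmbed (PolySite.incl hΛ) A)ᴴ *
          ((hubbardTTPrimeFermionInteraction t t' U).localHamiltonian Λ' * fermionEmbed (PolySite.incl hΛ) A -
            fermionEmbed (PolySite.incl hΛ) A * (hubbardTTPrimeFermionInteraction t t' U).localHamiltonian Λ')) -
        ((s : ℝ) : ℂ) • ((fermionEmbed (PolySite.incl hΛ) A)ᴴ * fermionEmbed (PolySite.incl hΛ) A) +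
        ((q : ℝ) : ℂ) • (fermionEmbed (PolySite.incl hΛ) A * (fermionEmbed (PolySite.incl hΛ) A)ᴴ))).re := by
  have hA : fermionEmbed (PolySite.incl hΛ) A =
      fermionEmbed (PolySite.incl h8) (fermionEmbed (PolySite.incl (subset_thicken Λ 1)) A) := by
    rw [fermionEmbed_fermionEmbed, PolySite.incl_trans]
  rw [hubbardTTPrime_localHamiltonian_commutator_fermionEmbed_eq t t' U hΛ h8 A, hA,
    ← fermionEmbed_conjTranspose, ← fermionEmbed_mul, ← fermionEmbed_mul, ← fermionEmbed_mul,
    ← fermionEmbed_smul, ← fermionEmbed_smul, ← fermionEmbed_smul, ← fermionEmbed_sub, ← fermionEmbed_add,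
    ω.compatible h8]
  exact hω.re_expect_eeb_nonneg_of_spinSectorGibbs t t' U β a b e hp hψ hLs hAN hAS hq

end InfVolFermionState

end Literature.MathematicalPhysics.QuantumLattice

end
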